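import Summits.BirchSwinnertonDyer.BirchSwinnertonDyer.Theorems.ByReductionTypeAtTwoSupersingularUniformFlatLine
import Literature.NumberTheory.EllipticCurves.Rank1Residual.MuLambdaCarriers
import Literature.NumberTheory.EllipticCurves.Kato2004.DivisibilityInputsZetaLine
import HarnessLib

/-!
# D-imc-84K (cell `bsd-f1-sign2`, seat `-imc` g32) — TURNKEY T-84 IN THE KERNEL: the ♭ upper divisibility at `2` and
# `MissingUpperBoundAt W 2` for EVERY curve of crux `SupersingularRankZeroAtTwo`'s habitat from the uniform ♭ data
# (stub 2, VERBATIM type) and **`FineMuZeroAt W 2` on the habitat (Conjecture A at 2) INSTEAD OF the `2`-adic image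
# split + the μ♭ stub** (`MuFlatOfNonSurjAtTwo`, stub 3 of `Lines/odd_blind_package.lean` v2.11 cd77963917e543d2).

HONEST FRAMING. Crux workfile; THEOREMS ONLY, no `sorry`, no new `def`; nothing asserted about any curve; BSD, the crux,
Conjecture A are NOT proved. Companion of `D84FineTwoClause.lean` (@3b1e0c1408e9, MEMO-imc §10.117). The two theorems
are the tree's `SSFlatRoad.flatUpper_two_of_flatColemanKato` (Theorems/…SupersingularFlatRoad.lean l.241) and
`SSFlatRoad.missingUpperBoundAt_two_of_uniformFlat` (Theorems/…SupersingularUniformFlatLine.lean l.63) COPIED VERBATIM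
with exactly these edits: (closer) binder `(hsurj : TwoAdicSurjective W)` ↦ `(hγ' : IsCyclotomicVariable 2 γ)
(hfine : FineMuZeroAt W 2)` and the ONE use `exact hES2 hsurj 𝔭 h1 h2` ↦ the D84 derivation (`Y.X` is f.g. by the tree
theorem `FineSelmerDualData.module_finite`, torsion by `hX0`; `(2)` is the unique height-one prime ∋ `C 2`; `μ(X₀) = 0`
⟹ `lengthAt Λ Y.X 𝔭 = 0 ≤ _`) — the package binder `hCK` is UNCHANGED (its guarded last conjunct is simply not used);
(consumer) binder `hμFlatAll : …` ↦ `hFine : ∀ W …habitat…, FineMuZeroAt W 2` and the `by_cases hsurj` two-branch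
ending ↦ one call of the new closer.  So a v2.12 registry needs only: `def FineMuZeroOnHabitatAtTwo : Prop := ∀ W …,
FineMuZeroAt W 2`, `theorem stub_fineMu : FineMuZeroOnHabitatAtTwo := by sorry` REPLACING `stub_allMuFlatOfNonSurj`, and
the call `missingUpperBoundAt_two_of_uniformFlat_of_fineMu hPub… h124 hX0 (uniformFlatDataAtTwo_of_honda stub_allFlatData)
stub_fineMu` (LEAD's decision and bytes; REF1 to audit; these theorems to be ported to `Theorems/` by a prover or `-ty` seat
verbatim — a planner seat does not propose Theorems files).
References: [Kato2004Asterisque, Thm. 12.4, 12.5 (4), 13.4 (3)] [Sprung2012, Thm. 7.14, 7.16, Prop. 7.19] [CoatesSujatha2005,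
§3 statement (A)] [Washington1997, §13.2]. PARTITION 52421 = 17880 + 27650 + 3440 + 3451 unchanged; beyond-print theorem:
no; BSD not proved; bears_on: stmt-BirchSwinnertonDyer-19097.
-/

set_option autoImplicit false
set_option linter.dupNamespace false
set_option linter.unusedVariables false

noncomputable section

open scoped Classical MatrixGroups ModularForm NumberField
open NumberField IsDedekindDomain CongruenceSubgroup WeierstrassCurve Literature.NumberTheory.EllipticCurves
  Literature.NumberTheory.EllipticCurves.ModularForms Literature.NumberTheory.EllipticCurves.Sprung2017
  Literature.NumberTheory.EllipticCurves.Sprung2012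
  Literature.NumberTheory.EllipticCurves.Rank1Residual Literature.NumberTheory.EllipticCurves.Rank1Residual.Typed
  Literature.NumberTheory.EllipticCurves.Kobayashi2003 Literature.NumberTheory.EllipticCurves.IwasawaDual
  Literature.NumberTheory.EllipticCurves.IwasawaAlgebra
  Literature.NumberTheory.GaloisRepresentations
  ZpExtension Summit.BirchSwinnertonDyer.Rank1Residual Summit.BirchSwinnertonDyer.Rank1Residual.Supersingular
  Summit.BirchSwinnertonDyer.Rank1Residual.X5.O1
open Summit.BirchSwinnertonDyer.BirchSwinnertonDyer.Theorems.SSFlatRoad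

universe u

namespace Summit.BirchSwinnertonDyer.BirchSwinnertonDyer.Cruxes.SupersingularRankZeroAtTwo.D84K

/-! ## §1 `Λ`-algebra (as in `D84FineTwoClause.lean`): `μ = 0` ⟹ local length `0` at the height-one prime over `p` -/

section Algebra

variable {p : ℕ} [Fact p.Prime]

/-- `μ(N) = 0` for a finitely generated torsion `Λ`-module ⟹ `lengthAt Λ N 𝔭 = 0` at every height-one `𝔭 ∋ C p`.
[cite: Washington1997, §13.2] -/
theorem lengthAt_eq_zero_of_muInvariant_eq_zero (N : Type*) [AddCommGroup N] [Module (IwasawaAlgebra p) N]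
    [Module.Finite (IwasawaAlgebra p) N] (hN : Module.IsTorsion (IwasawaAlgebra p) N) (hμ : muInvariant p N = 0)
    (𝔭 : PrimeSpectrum (IwasawaAlgebra p)) (h1 : 𝔭.asIdeal.height = 1)
    (hp : (PowerSeries.C (p : ℤ_[p]) : IwasawaAlgebra p) ∈ 𝔭.asIdeal) :
    Module.lengthAt (IwasawaAlgebra p) N 𝔭 = 0 := by
  have h𝔭 : 𝔭.asIdeal = augIdealP p := Kato2004.eq_augIdealP_of_height_eq_one_of_C_mem 𝔭 h1 hp
  have hne : Module.lengthAt (IwasawaAlgebra p) N 𝔭 ≠ ⊤ := lengthAt_ne_top_of_isTorsion p N hN 𝔭 h𝔭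
  have h := muInvariant_eq_toNat_lengthAt p N 𝔭 h𝔭
  rw [hμ] at h
  rcases (ENat.toNat_eq_zero.mp h.symm) with h0 | htop
  · exact h0
  · exact absurd htop hne

end Algebra

/-! ## §2 The closer: ♭ upper divisibility at `2` from Kato's facts, the ♭ package (stub 2's type VERBATIM) and `FineMuZeroAt W 2` -/

section AtTwo

variable (W : WeierstrassCurve ℚ) [W.IsElliptic] [W.IsGloballyMinimal]
  {κ : ZpExtension ℚ 2} {γ : Field.absoluteGaloisGroup ℚ}
  {E : Type} [Field E] [Algebra ℚ E] (ι : AlgebraicClosure ℚ →ₐ[ℚ] AlgebraicClosure E)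
  (g : Field.absoluteGaloisGroup E) (c : ℕ → localPoints W E)

/-- **T-84 closer.** `SSFlatRoad.flatUpper_two_of_flatColemanKato` with the `2`-adic image certificate REPLACED by
`FineMuZeroAt W 2` (statement (A) at `(E,2)`): same package binder `hCK` (stub 2's CK♭ clause verbatim, its guarded
`(2)`-conjunct unused), same conclusion. [cite: Kato2004Asterisque, Thm. 12.4 (p. 221), Thm. 12.5 (4) (p. 222)]
[cite: Sprung2012, Thm. 7.14, Thm. 7.16 and Prop. 7.19 (pp. 1504–1505)] [cite: CoatesSujatha2005, §3 statement (A)] -/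
theorem flatUpper_two_of_flatColemanKato_of_fineMu (h124 : Kato2004.thm12_4)
    (hX0 : Kato2004_fineSelmerDual_isTorsion)
    (hgood : W.HasGoodReductionAtPrime 2) (hss : (2 : ℤ) ∣ W.frobeniusTrace 2)
    (hL : W.entireLFunction 1 ≠ 0)
    (hκ : κ.IsCyclotomic) (hγ : κ.IsTopGenerator γ) (hγ' : IsCyclotomicVariable 2 γ)
    (hfine : FineMuZeroAt W 2)
    (hCK : ∀ [NeZero (W.conductorNorm ℤ)] (f : CuspForm (Gamma0 (W.conductorNorm ℤ)) 2),
        IsNewformOf W f → ∀ (ϖ : ℚ), (ϖ : ℝ) * W.realPeriodRat = plusPeriod f →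
      ∀ (Ls Lf : IwasawaAlgebra 2), IsSprungPair f 2 (W.frobeniusTrace 2) Ls Lf →
      ∀ (D : SharpFlatSelmerDualData W κ γ ι (W.frobeniusTrace 2) g c .flat)
        [ContinuousSMul ℤ_[2] (W.tateModule 2)],
        ∃ (I : Kato2004.IwasawaH1Data W 2 κ γ) (Y : W.FineSelmerDualData κ γ)
          (P : Submodule (IwasawaAlgebra 2) (IwasawaAlgebra 2))
          (loc : I.H →ₗ[IwasawaAlgebra 2] P) (toX : P →ₗ[IwasawaAlgebra 2] D.X)
          (δ : D.X →ₗ[IwasawaAlgebra 2] Y.X) (Z : Submodule (IwasawaAlgebra 2) I.H)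
          (G : IwasawaAlgebra 2),
          Function.Exact loc toX ∧ Function.Exact toX δ ∧
          G ∈ Submodule.map (P.subtype ∘ₗ loc) Z ∧
          iwasawaToPowerSeries 2 G = PowerSeries.C (ϖ : ℚ_[2]) * iwasawaToPowerSeries 2 Lf ∧
          (∀ 𝔭 : PrimeSpectrum (IwasawaAlgebra 2), 𝔭.asIdeal.height = 1 →
            PowerSeries.C (2 : ℤ_[2]) ∉ 𝔭.asIdeal →
            Literature.NumberTheory.EllipticCurves.Module.lengthAt (IwasawaAlgebra 2) Y.X 𝔭 ≤
              Literature.NumberTheory.EllipticCurves.Module.lengthAt (IwasawaAlgebra 2) (I.H ⧸ Z) 𝔭) ∧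
          (TwoAdicSurjective W →
            ∀ 𝔭 : PrimeSpectrum (IwasawaAlgebra 2), 𝔭.asIdeal.height = 1 →
              PowerSeries.C (2 : ℤ_[2]) ∈ 𝔭.asIdeal →
              Literature.NumberTheory.EllipticCurves.Module.lengthAt (IwasawaAlgebra 2) Y.X 𝔭 ≤
                Literature.NumberTheory.EllipticCurves.Module.lengthAt (IwasawaAlgebra 2) (I.H ⧸ Z) 𝔭)) :
    ∀ [NeZero (W.conductorNorm ℤ)] (f : CuspForm (Gamma0 (W.conductorNorm ℤ)) 2),
        IsNewformOf W f → ∀ (ϖ : ℚ), (ϖ : ℝ) * W.realPeriodRat = plusPeriod f →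
      ∀ (Ls Lf : IwasawaAlgebra 2), IsSprungPair f 2 (W.frobeniusTrace 2) Ls Lf →
      ∀ (D : SharpFlatSelmerDualData W κ γ ι (W.frobeniusTrace 2) g c .flat),
        Module.IsTorsion (IwasawaAlgebra 2) D.X ∧
        ∃ g' h : IwasawaAlgebra 2, D.charIdeal = Ideal.span {g'} ∧
          iwasawaToPowerSeries 2 (g' * h) = PowerSeries.C (ϖ : ℚ_[2]) * iwasawaToPowerSeries 2 Lf := by
  intro _ f hf ϖ hϖ Ls Lf hSP D
  haveI : ContinuousSMul ℤ_[2] (W.tateModule 2) := TateModule.continuousSMul_padicInt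
  obtain ⟨I, Y, P, loc, toX, δ, Z, G, hPX, hXY, hGZ, hιG, hESrat, hES2⟩ := hCK f hf ϖ hϖ Ls Lf hSP D
  have hY : Module.IsTorsion (IwasawaAlgebra 2) Y.X := hX0 W 2 κ γ hκ hγ Y
  obtain ⟨htf, hrank⟩ := h124.isTorsionFree_and_rank_le_one W 2 hκ hγ I
  haveI := htf
  -- `G ≠ 0`: `ϖ ≠ 0` (else `Ω⁺_f = 0`, contradicting `L(E,1) = [0]⁺·Ω⁺_f ≠ 0`) and `L♭ ≠ 0`
  have hLf : Lf ≠ 0 := flat_ne_zero_two W hf hgood hss hL hSP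
  have hϖ0 : ϖ ≠ 0 := by
    intro h0
    apply hL
    rw [hf.entireLFunction_one_eq, ← hϖ, h0]
    simp
  have hG : G ≠ 0 := by
    intro h0
    rw [h0, map_zero] at hιG
    have h1 : PowerSeries.C (ϖ : ℚ_[2]) * iwasawaToPowerSeries 2 Lf ≠ 0 := by
      refine mul_ne_zero ?_ ?_
      · intro hC
        have := congrArg PowerSeries.constantCoeff hC
        simp only [PowerSeries.constantCoeff_C, map_zero] at this
        exact hϖ0 (by exact_mod_cast this)
      · intro hz
        exact hLf ((iwasawaToPowerSeries_injective 2) (by rw [hz, map_zero]))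
    exact h1 hιG.symm
  have hES : ∀ 𝔭 : PrimeSpectrum (IwasawaAlgebra 2), 𝔭.asIdeal.height = 1 →
      Literature.NumberTheory.EllipticCurves.Module.lengthAt (IwasawaAlgebra 2) Y.X 𝔭 ≤
        Literature.NumberTheory.EllipticCurves.Module.lengthAt (IwasawaAlgebra 2) (I.H ⧸ Z) 𝔭 := by
    intro 𝔭 h1
    by_cases h2 : PowerSeries.C (2 : ℤ_[2]) ∈ 𝔭.asIdeal
    · -- D-imc-84: at the unique height-one prime `(2) ∋ 2` the clause is `μ(X₀) ≤ μ(𝐇¹/Z)`; `μ(X₀) = 0`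
      -- (`FineMuZeroAt W 2`, statement (A) at `(E,2)`) makes it hold with NO image hypothesis (`hES2` unused).
      have hYf : Module.Finite (IwasawaAlgebra 2) Y.X :=
        WeierstrassCurve.FineSelmerDualData.module_finite W κ hγ Y
      have hμ : muInvariant 2 Y.X = 0 := hfine κ γ hκ hγ hγ' Y hYf hY
      rw [lengthAt_eq_zero_of_muInvariant_eq_zero Y.X hY hμ 𝔭 h1 h2]
      exact zero_le
    · exact hESrat 𝔭 h1 h2
  refine ⟨sharpFlatSelmerDual_isTorsion_of_colemanSkeleton I hrank Y D loc P.subtype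
      P.injective_subtype toX δ hPX hXY hY Z hG hGZ, ?_⟩
  obtain ⟨g', h, hg, hgh⟩ := exists_charGenerator_mul_eq_of_colemanSkeleton' hγ I hrank Y D loc
    P.subtype P.injective_subtype toX δ hPX hXY hY Z hGZ hES
  exact ⟨g', h, hg, by rw [hgh]; exact hιG⟩

end AtTwo

/-! ## §3 The consumer: `MissingUpperBoundAt W 2` on the whole habitat from PUB, Kato's facts, the uniform ♭ data and (A) at 2 -/

/-- **T-84 consumer.** `SSFlatRoad.missingUpperBoundAt_two_of_uniformFlat` with the μ♭ stub binder `hμFlatAll` REPLACED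
by `hFine : ∀ W …habitat…, FineMuZeroAt W 2` and the `by_cases TwoAdicSurjective W` ending replaced by ONE call of
`flatUpper_two_of_flatColemanKato_of_fineMu`; `hPub`, `h124`, `hX0`, `hFlatAll` binders VERBATIM.
[cite: Kato2004Asterisque, Thm. 12.4, 12.5] [cite: Sprung2012, Thm. 7.14, 7.16] [cite: CoatesSujatha2005, §3 statement (A)] -/
theorem missingUpperBoundAt_two_of_uniformFlat_of_fineMu
    (hPub : nonempty_modularParametrizationData ∧ rank_eq_analyticRank_of_analyticRank_le_one)
    (h124 : Kato2004.thm12_4) (hX0 : Kato2004_fineSelmerDual_isTorsion)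
    (hFlatAll :
      ∀ (W : WeierstrassCurve ℚ) [W.IsElliptic] [W.IsGloballyMinimal],
      ¬ W.HasCM → W.analyticRank = 0 → GoodSS W 2 →
      ∀ (κ : ZpExtension ℚ 2) (γ : Field.absoluteGaloisGroup ℚ),
        κ.IsCyclotomic → κ.IsTopGenerator γ → IsCyclotomicVariable 2 γ →
      ∀ (v : HeightOneSpectrum (𝓞 ℚ)), (2 : 𝓞 ℚ) ∈ v.asIdeal →
      ∃ (g : Field.absoluteGaloisGroup (v.adicCompletion ℚ)) (c : ℕ → localPoints W (v.adicCompletion ℚ)),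
        κ.IsTopGenerator (resGalOfEmb (closureEmb (K := ℚ) (v.adicCompletion ℚ)) g) ∧
        (∀ n, c n ∈ localLayerPointsOfEmb κ (closureEmb (K := ℚ) (v.adicCompletion ℚ)) W n) ∧
        (∀ n, 1 ≤ n → localTraceOfEmb κ (closureEmb (K := ℚ) (v.adicCompletion ℚ)) W n (n + 1)
          (c (n + 1)) = W.frobeniusTrace 2 • c n - c (n - 1)) ∧
        (∀ z₀ : localLayerPointsOfEmb κ (closureEmb (K := ℚ) (v.adicCompletion ℚ)) W 0 →+ ℤ_[2],
          evalOn W (localLayerPointsOfEmb κ (closureEmb (K := ℚ) (v.adicCompletion ℚ)) W 0) z₀ (c 0) = 0 →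
            z₀ = 0) ∧
        (∀ a : ℤ_[2],
          (∃ z₀ : localLayerPointsOfEmb κ (closureEmb (K := ℚ) (v.adicCompletion ℚ)) W 0 →+ ℤ_[2],
            evalOn W (localLayerPointsOfEmb κ (closureEmb (K := ℚ) (v.adicCompletion ℚ)) W 0) z₀ (c 0) =
              2 * a) →
          ∃ y : localLayerPointsOfEmb κ (closureEmb (K := ℚ) (v.adicCompletion ℚ)) W 0 →+ ℤ_[2],
            evalOn W (localLayerPointsOfEmb κ (closureEmb (K := ℚ) (v.adicCompletion ℚ)) W 0) y (c 0) = a) ∧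
        (Finite (W.selmerGroupPInfty 2) →
          Finite (EndCoinvariants (conjSharpFlatSelmerInfty W κ (closureEmb (K := ℚ) (v.adicCompletion ℚ))
            (W.frobeniusTrace 2) g c .flat γ - 1)) →
          Nat.card (↥((sharpFlatSelmerInfty W κ (closureEmb (K := ℚ) (v.adicCompletion ℚ))
                (W.frobeniusTrace 2) g c .flat).comap (W.layerToInfty κ 0)) ⧸
              (W.selmerLayer κ 0).addSubgroupOf
                ((sharpFlatSelmerInfty W κ (closureEmb (K := ℚ) (v.adicCompletion ℚ))
                  (W.frobeniusTrace 2) g c .flat).comap (W.layerToInfty κ 0))) *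
            Nat.card (MulAction.fixedPoints (Field.absoluteGaloisGroup ℚ) (W.geomPrimaryTorsion 2)) =
          2 ^ (padicValNat 2 W.tamagawaProduct) *
            Nat.card (EndCoinvariants (conjSharpFlatSelmerInfty W κ
              (closureEmb (K := ℚ) (v.adicCompletion ℚ)) (W.frobeniusTrace 2) g c .flat γ - 1))) ∧
        (∀ [NeZero (W.conductorNorm ℤ)] (f : CuspForm (Gamma0 (W.conductorNorm ℤ)) 2),
            IsNewformOf W f → ∀ (ϖ : ℚ), (ϖ : ℝ) * W.realPeriodRat = plusPeriod f →
          ∀ (Ls Lf : IwasawaAlgebra 2), IsSprungPair f 2 (W.frobeniusTrace 2) Ls Lf →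
          ∀ (D : SharpFlatSelmerDualData W κ γ (closureEmb (K := ℚ) (v.adicCompletion ℚ))
              (W.frobeniusTrace 2) g c .flat) [ContinuousSMul ℤ_[2] (W.tateModule 2)],
            ∃ (I : Kato2004.IwasawaH1Data W 2 κ γ) (Y : W.FineSelmerDualData κ γ)
              (P : Submodule (IwasawaAlgebra 2) (IwasawaAlgebra 2))
              (loc : I.H →ₗ[IwasawaAlgebra 2] P) (toX : P →ₗ[IwasawaAlgebra 2] D.X)
              (δ : D.X →ₗ[IwasawaAlgebra 2] Y.X) (Z : Submodule (IwasawaAlgebra 2) I.H)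
              (G : IwasawaAlgebra 2),
              Function.Exact loc toX ∧ Function.Exact toX δ ∧
              G ∈ Submodule.map (P.subtype ∘ₗ loc) Z ∧
              iwasawaToPowerSeries 2 G = PowerSeries.C (ϖ : ℚ_[2]) * iwasawaToPowerSeries 2 Lf ∧
              (∀ 𝔭 : PrimeSpectrum (IwasawaAlgebra 2), 𝔭.asIdeal.height = 1 →
                PowerSeries.C (2 : ℤ_[2]) ∉ 𝔭.asIdeal →
                Literature.NumberTheory.EllipticCurves.Module.lengthAt (IwasawaAlgebra 2) Y.X 𝔭 ≤
                  Literature.NumberTheory.EllipticCurves.Module.lengthAt (IwasawaAlgebra 2) (I.H ⧸ Z) 𝔭) ∧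
              (TwoAdicSurjective W →
                ∀ 𝔭 : PrimeSpectrum (IwasawaAlgebra 2), 𝔭.asIdeal.height = 1 →
                  PowerSeries.C (2 : ℤ_[2]) ∈ 𝔭.asIdeal →
                  Literature.NumberTheory.EllipticCurves.Module.lengthAt (IwasawaAlgebra 2) Y.X 𝔭 ≤
                    Literature.NumberTheory.EllipticCurves.Module.lengthAt (IwasawaAlgebra 2) (I.H ⧸ Z) 𝔭)))
    (hFine : ∀ (W : WeierstrassCurve ℚ) [W.IsElliptic] [W.IsGloballyMinimal],
      ¬ W.HasCM → W.analyticRank = 0 → GoodSS W 2 → FineMuZeroAt W 2) :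
    ∀ (W : WeierstrassCurve ℚ) [W.IsElliptic] [W.IsGloballyMinimal],
      ¬ W.HasCM → W.analyticRank = 0 → GoodSS W 2 → MissingUpperBoundAt W 2 := by
  intro W _ _ hcm hr hss
  have hL : W.entireLFunction 1 ≠ 0 := Summit.BirchSwinnertonDyer.BirchSwinnertonDyer.Theorems.entireLFunction_one_ne_zero_of_analyticRank_eq_zero W hPub.1 hr
  obtain ⟨κ, hκ, γ, hγ, hγ'⟩ := exists_isCyclotomic_isTopGenerator_isCyclotomicVariable_holds 2
  set v : HeightOneSpectrum (𝓞 ℚ) := (Rat.HeightOneSpectrum.primesEquiv (R := 𝓞 ℚ)).symm ⟨2, Nat.prime_two⟩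
    with hv_def
  have hv : (2 : 𝓞 ℚ) ∈ v.asIdeal := by
    have h := natCast_mem_asIdeal_primesEquiv_symm 2 Nat.prime_two
    simpa [hv_def] using h
  obtain ⟨g, c, hg, hc, hTr, hinj, hsat, hcount, hCK⟩ := hFlatAll W hcm hr hss κ γ hκ hγ hγ' v hv
  have hEC : ∀ (D : SharpFlatSelmerDualData W κ γ (closureEmb (K := ℚ) (v.adicCompletion ℚ))
      (W.frobeniusTrace 2) g c .flat) [Module.Finite (IwasawaAlgebra 2) D.X],
      Module.IsTorsion (IwasawaAlgebra 2) D.X →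
      ∀ f : IwasawaAlgebra 2, D.charIdeal = Ideal.span {f} → Finite (W.selmerGroupPInfty 2) →
        ∃ u : ℤ_[2]ˣ, ((PowerSeries.constantCoeff f : ℤ_[2]) : ℚ_[2]) =
          ((u : ℤ_[2]) : ℚ_[2]) * ((2 : ℕ) : ℚ_[2]) ^ (padicValNat 2 W.tamagawaProduct) *
            (Nat.card (W.selmerGroupPInfty 2) : ℚ_[2]) :=
    fun D _ hX f hf hfin ↦ flatEulerChar_two W hss κ hγ hv hg hc hTr hinj hsat hcount D hX f hf hfin
  -- D-imc-84: ONE branch for every curve of the habitat — no `by_cases TwoAdicSurjective W`, no μ♭ stub.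
  exact missingUpperBoundAt_two_of_flatUpper W _ g c hPub.1 hPub.2 hss.1 hss.2 hL hγ hEC
    (flatUpper_two_of_flatColemanKato_of_fineMu W _ g c h124 hX0 hss.1 hss.2 hL hκ hγ hγ' (hFine W hcm hr hss) hCK)

end Summit.BirchSwinnertonDyer.BirchSwinnertonDyer.Cruxes.SupersingularRankZeroAtTwo.D84K

end
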